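import Mathlib
import Summits.ValiantsHypothesis.ValiantsHypothesis.Theorems.KPlusLogSqLawStepSharpFamily

/-!
# Family `M'(d)`: every window is separated (sharpness of the plateau length law, every odd reach — part 2)

Cell pub-symmetroid, seat conjb-2 (g22). A helper toward the crux `TropicalB`
(`Summit.ValiantsHypothesis.ValiantsHypothesis.Theses.KPlusLogSqLaw.TropicalB`, item
`stmt-ValiantsHypothesis-19771`); it earns no crux credit and is not evidence for `MatrixDescartes` or for
Valiant's hypothesis. Imports only Mathlib and the data file `KPlusLogSqLawStepSharpFamily`.

Static path model and family M' as in `KPlusLogSqLawStepSharpFamily` (`d = 2n+1`, lines `S_t(x) = bM n t + sM n t * x`,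
even index = upper class; window `[j, j+d]` separated at `x` iff every even line of it is strictly above every odd one).
Here: the DISPATCH form of the vertex lemmas (`EM_strict`: a line `t ∈ [j+2, j+d]` lies strictly on its class's side of
the vertex `X_j`; `EM_weak`: every line `t ∈ [j, j+d+1]` weakly), and the SEPARATION of all `d + 3` windows of the
extremal configuration: window `j` (`1 ≤ j ≤ d`) at the midpoint `j - 1/2` of `[x_{j-1}, x_j]` (average of the two
vertex inequalities, one of them strict because the binding pair is not `{j, j}`), window `0` at `-ε`, window `d+1` at
`x_d + ε`, window `d+2` at `x_d - ε` (integer margin `≥ 1` at the vertex against a slope term `< 1`, the tight pairs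
`{0,1}`, `{d+1,2d+1}`, `{2d+2,2d+1}` through the vertex being separated by the sign of `ε` alone), for any
`0 < ε ≤ 1/((n+1)(2n+3)+4n+5)`. The sequel `KPlusLogSqLawStepSharpAll` adds the non-separation of consecutive windows and
the main theorem.
-/

set_option linter.dupNamespace false

namespace Summit.ValiantsHypothesis.ValiantsHypothesis.Theorems.KPlusLogSqLawStepSharpWindows

open Summit.ValiantsHypothesis.ValiantsHypothesis.Theorems.KPlusLogSqLawStepSharpFamily

/-! ## Dispatch: the vertex lemma for an arbitrary line of the window -/

/-- Strict form: a line `t ∈ [j+2, j+d]` at vertex `j` lies strictly on its class's side. -/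
theorem EM_strict (n t j : ℕ) (hj : j ≤ 2 * n + 1) (h1 : j + 2 ≤ t) (h2 : t ≤ j + (2 * n + 1)) :
    (Even t → 0 < EM n t j) ∧ (¬ Even t → EM n t j < 0) := by
  rcases Nat.even_or_odd t with ⟨i, hi⟩ | ⟨i, hi⟩
  · -- even line t = 2i
    have ht : t = 2 * i := by omega
    subst ht
    have hev : Even (2 * i) := ⟨i, by ring⟩
    refine ⟨fun _ => ?_, fun ho => absurd hev ho⟩
    by_cases hA : 2 * i ≤ 2 * n
    · exact EM_evenEdge n i j (by omega) h1
    by_cases hB : 2 * i = 2 * n + 2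
    · rw [hB]; exact EM_chordPos n j (by omega) (by omega)
    · obtain ⟨r, hr⟩ : ∃ r, i = n + 1 + r := ⟨i - (n + 1), by omega⟩
      subst hr
      have e : 2 * (n + 1 + r) = 2 * n + 2 + 2 * r := by ring
      rw [e]
      exact EM_upperWh n r j (by omega) (by omega) (by omega) hj
  · -- odd line t = 2i+1
    subst hi
    have hod : ¬ Even (2 * i + 1) := by rw [Nat.even_add_one]; exact fun h => h ⟨i, by ring⟩
    refine ⟨fun he => absurd he hod, fun _ => ?_⟩
    by_cases hA : 2 * i + 1 ≤ 2 * n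
    · exact EM_oddEdge n i j (by omega) h1
    by_cases hB : 2 * i + 1 = 2 * n + 1
    · rw [hB]; exact EM_lastEdge n j (by omega)
    · obtain ⟨c, hc⟩ : ∃ c, i = n + c := ⟨i - n, by omega⟩
      subst hc
      have e : 2 * (n + c) + 1 = 2 * n + 1 + 2 * c := by ring
      rw [e]
      exact EM_lowerWh n c j (by omega) (by omega) (by omega) hj

/-- Weak form: every line `t ∈ [j, j+d+1]` (and `t = 2d+2` when `j = d`) at vertex `j` lies weakly on its class's side. -/
theorem EM_weak (n t j : ℕ) (hj : j ≤ 2 * n + 1) (h1 : j ≤ t)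
    (h2 : t ≤ j + (2 * n + 2) ∨ (t = 4 * n + 4 ∧ j = 2 * n + 1)) :
    (Even t → 0 ≤ EM n t j) ∧ (¬ Even t → EM n t j ≤ 0) := by
  by_cases ha : t = j
  · subst ha; rw [EM_self n t hj]; exact ⟨fun _ => le_rfl, fun _ => le_rfl⟩
  by_cases hb : t = j + 1
  · subst hb; rw [EM_succ n j hj]; exact ⟨fun _ => le_rfl, fun _ => le_rfl⟩
  by_cases hc : t = j + (2 * n + 2)
  · subst hc; rw [EM_far n j hj]; exact ⟨fun _ => le_rfl, fun _ => le_rfl⟩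
  by_cases hd : t = 4 * n + 4 ∧ j = 2 * n + 1
  · obtain ⟨rfl, rfl⟩ := hd; rw [EM_top n]; exact ⟨fun _ => le_rfl, fun _ => le_rfl⟩
  have h2' : t ≤ j + (2 * n + 1) := by omega
  have hs := EM_strict n t j hj (by omega) h2'
  exact ⟨fun he => le_of_lt (hs.1 he), fun ho => le_of_lt (hs.2 ho)⟩

/-! ## Line values in terms of the vertex excess -/

/-- Value of line `t` at `x` in terms of its excess at the vertex `X_j`. -/
theorem val_at (n t j : ℕ) (x : ℝ) :
    (bM n t : ℝ) + (sM n t : ℝ) * x = (EM n t j : ℝ) + (yM n j : ℝ) + (sM n t : ℝ) * (x - j) := by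
  unfold EM; push_cast; ring

/-! ## Separation of the windows -/

/-- Windows `1 ≤ j ≤ d` are separated at the midpoint `j - 1/2` of `[x_{j-1}, x_j]`. -/
theorem window_mid (n j : ℕ) (hn : 1 ≤ n) (hj1 : 1 ≤ j) (hj2 : j ≤ 2 * n + 1) (e o : ℕ)
    (he1 : j ≤ e) (he2 : e ≤ j + (2 * n + 1)) (ho1 : j ≤ o) (ho2 : o ≤ j + (2 * n + 1))
    (he : Even e) (ho : ¬ Even o) :
    (bM n o : ℝ) + (sM n o : ℝ) * ((j : ℝ) - 1 / 2) < (bM n e : ℝ) + (sM n e : ℝ) * ((j : ℝ) - 1 / 2) := by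
  -- weak inequalities at the two flanking vertices j-1 and j
  have wE0 := (EM_weak n e (j - 1) (by omega) (by omega) (Or.inl (by omega))).1 he
  have wE1 := (EM_weak n e j hj2 he1 (Or.inl (by omega))).1 he
  have wO0 := (EM_weak n o (j - 1) (by omega) (by omega) (Or.inl (by omega))).2 ho
  have wO1 := (EM_weak n o j hj2 ho1 (Or.inl (by omega))).2 ho
  -- one strict inequality
  have key : EM n o (j - 1) + EM n o j < EM n e (j - 1) + EM n e j := by
    by_cases hoj : o = j + 1
    · have := (EM_strict n o (j - 1) (by omega) (by omega) (by omega)).2 ho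
      linarith
    by_cases hoj' : o = j
    · have hej : e ≠ j := fun h => ho (hoj' ▸ h ▸ he)
      by_cases hej' : e = j + 1
      · have := (EM_strict n e (j - 1) (by omega) (by omega) (by omega)).1 he
        linarith
      · have := (EM_strict n e j hj2 (by omega) he2).1 he
        linarith
    · have := (EM_strict n o j hj2 (by omega) ho2).2 ho
      linarith
  -- value at the midpoint = average of the values at the two vertices
  have hcast : ((j - 1 : ℕ) : ℝ) = (j : ℝ) - 1 := by
    rw [Nat.cast_sub hj1]; push_cast; ring
  have H : ∀ t : ℕ, (bM n t : ℝ) + (sM n t : ℝ) * ((j : ℝ) - 1 / 2)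
      = ((EM n t (j - 1) : ℝ) + yM n (j - 1) + ((EM n t j : ℝ) + yM n j)) / 2 := by
    intro t
    have h0 := val_at n t (j - 1) ((j : ℝ) - 1 / 2)
    have h1 := val_at n t j ((j : ℝ) - 1 / 2)
    rw [hcast] at h0
    linarith
  rw [H o, H e]
  have key' : ((EM n o (j - 1) : ℤ) : ℝ) + (EM n o j : ℤ) < (EM n e (j - 1) : ℤ) + (EM n e j : ℤ) := by
    exact_mod_cast key
  linarith

/-- Bound on a slope difference against the offset `ε`. -/
theorem slope_diff_small (n e o : ℕ) (he : e ≤ 4 * n + 4) (ho : o ≤ 4 * n + 4) (ε : ℝ) (hε : 0 < ε)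
    (hεB : ε * ((n + 1) * (2 * n + 3) + 4 * n + 5 : ℝ) ≤ 1) :
    |((sM n e : ℝ) - sM n o) * ε| < 1 := by
  have h1 := sM_nonneg n e
  have h2 := sM_nonneg n o
  have h3 := sM_le n e
  have h4 := sM_le n o
  have b1 : (0 : ℝ) ≤ sM n e := by exact_mod_cast h1
  have b2 : (0 : ℝ) ≤ sM n o := by exact_mod_cast h2
  have b3 : (sM n e : ℝ) ≤ (n + 1) * (2 * n + 3) + 4 * n + 4 := by
    have : (sM n e : ℝ) ≤ (n + 1) * (2 * n + 3) + e := by exact_mod_cast h3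
    have : (e : ℝ) ≤ 4 * n + 4 := by exact_mod_cast he
    linarith
  have b4 : (sM n o : ℝ) ≤ (n + 1) * (2 * n + 3) + 4 * n + 4 := by
    have : (sM n o : ℝ) ≤ (n + 1) * (2 * n + 3) + o := by exact_mod_cast h4
    have : (o : ℝ) ≤ 4 * n + 4 := by exact_mod_cast ho
    linarith
  rw [abs_lt]
  constructor <;> nlinarith

/-- Window `0` is separated at `-ε`. -/
theorem window_zero (n : ℕ) (hn : 1 ≤ n) (ε : ℝ) (hε : 0 < ε)
    (hεB : ε * ((n + 1) * (2 * n + 3) + 4 * n + 5 : ℝ) ≤ 1) (e o : ℕ)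
    (he2 : e ≤ 2 * n + 1) (ho2 : o ≤ 2 * n + 1) (he : Even e) (ho : ¬ Even o) :
    (bM n o : ℝ) + (sM n o : ℝ) * (-ε) < (bM n e : ℝ) + (sM n e : ℝ) * (-ε) := by
  rw [val_at n o 0, val_at n e 0]
  have wE := (EM_weak n e 0 (by omega) (Nat.zero_le _) (Or.inl (by omega))).1 he
  have wO := (EM_weak n o 0 (by omega) (Nat.zero_le _) (Or.inl (by omega))).2 ho
  have hsd := slope_diff_small n e o (by omega) (by omega) ε hε hεB
  rw [abs_lt] at hsd
  by_cases htight : e = 0 ∧ o = 1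
  · obtain ⟨rfl, rfl⟩ := htight
    have h0 : EM n 0 0 = 0 := EM_self n 0 (by omega)
    have h1 : EM n 1 0 = 0 := EM_succ n 0 (by omega)
    have s0 : sM n 0 = 2 * n + 2 := by have := sM_u n 0 (Nat.zero_le _); simpa using this
    have s1 : sM n 1 = 2 * n + 3 := by have := sM_l n 0 (by omega); simpa using this
    rw [h0, h1, s0, s1]; push_cast; nlinarith
  · have key : EM n o 0 + 1 ≤ EM n e 0 := by
      by_cases he0 : e = 0
      · have ho1 : o ≠ 1 := fun h => htight ⟨he0, h⟩
        have ho3 : 0 + 2 ≤ o := by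
          rcases Nat.even_or_odd o with ⟨c, hc⟩ | ⟨c, hc⟩
          · exact absurd ⟨c, by omega⟩ ho
          · omega
        have := (EM_strict n o 0 (by omega) ho3 (by omega)).2 ho
        linarith
      · have he3 : 0 + 2 ≤ e := by
          rcases Nat.even_or_odd e with ⟨c, hc⟩ | ⟨c, hc⟩
          · omega
          · exact absurd he (by rw [Nat.even_iff]; omega)
        have := (EM_strict n e 0 (by omega) he3 (by omega)).1 he
        linarith
    have key' : ((EM n o 0 : ℤ) : ℝ) + 1 ≤ (EM n e 0 : ℤ) := by exact_mod_cast key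
    push_cast
    nlinarith

/-- Window `d+1` is separated at `x_d + ε`. -/
theorem window_dsucc (n : ℕ) (ε : ℝ) (hε : 0 < ε)
    (hεB : ε * ((n + 1) * (2 * n + 3) + 4 * n + 5 : ℝ) ≤ 1) (e o : ℕ)
    (he1 : 2 * n + 2 ≤ e) (he2 : e ≤ 2 * n + 2 + (2 * n + 1)) (ho1 : 2 * n + 2 ≤ o)
    (ho2 : o ≤ 2 * n + 2 + (2 * n + 1)) (he : Even e) (ho : ¬ Even o) :
    (bM n o : ℝ) + (sM n o : ℝ) * ((2 * n + 1 : ℕ) + ε) <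
      (bM n e : ℝ) + (sM n e : ℝ) * ((2 * n + 1 : ℕ) + ε) := by
  rw [val_at n o (2 * n + 1), val_at n e (2 * n + 1)]
  have wE := (EM_weak n e (2 * n + 1) le_rfl (by omega) (Or.inl (by omega))).1 he
  have wO := (EM_weak n o (2 * n + 1) le_rfl (by omega) (Or.inl (by omega))).2 ho
  have hsd := slope_diff_small n e o (by omega) (by omega) ε hε hεB
  rw [abs_lt] at hsd
  by_cases htight : e = 2 * n + 2 ∧ o = 4 * n + 3
  · obtain ⟨rfl, rfl⟩ := htight
    have h0 : EM n (2 * n + 2) (2 * n + 1) = 0 := EM_succ n (2 * n + 1) le_rfl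
    have h1 : EM n (4 * n + 3) (2 * n + 1) = 0 := by
      have := EM_far n (2 * n + 1) le_rfl
      have e : 2 * n + 1 + (2 * n + 2) = 4 * n + 3 := by ring
      rwa [e] at this
    rw [h0, h1, sM_chord, sM_l2d1]; push_cast; nlinarith
  · have key : EM n o (2 * n + 1) + 1 ≤ EM n e (2 * n + 1) := by
      by_cases he0 : e = 2 * n + 2
      · have ho1 : o ≠ 4 * n + 3 := fun h => htight ⟨he0, h⟩
        have ho3 : o ≤ 2 * n + 1 + (2 * n + 1) := by
          rcases Nat.even_or_odd o with ⟨c, hc⟩ | ⟨c, hc⟩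
          · exact absurd ⟨c, by omega⟩ ho
          · omega
        have ho4 : 2 * n + 1 + 2 ≤ o := by
          rcases Nat.even_or_odd o with ⟨c, hc⟩ | ⟨c, hc⟩
          · exact absurd ⟨c, by omega⟩ ho
          · omega
        have := (EM_strict n o (2 * n + 1) le_rfl ho4 ho3).2 ho
        linarith
      · have he3 : 2 * n + 1 + 2 ≤ e := by
          rcases Nat.even_or_odd e with ⟨c, hc⟩ | ⟨c, hc⟩
          · omega
          · exact absurd he (by rw [Nat.even_iff]; omega)
        have he4 : e ≤ 2 * n + 1 + (2 * n + 1) := by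
          rcases Nat.even_or_odd e with ⟨c, hc⟩ | ⟨c, hc⟩
          · omega
          · exact absurd he (by rw [Nat.even_iff]; omega)
        have := (EM_strict n e (2 * n + 1) le_rfl he3 he4).1 he
        linarith
    have key' : ((EM n o (2 * n + 1) : ℤ) : ℝ) + 1 ≤ (EM n e (2 * n + 1) : ℤ) := by exact_mod_cast key
    push_cast
    nlinarith

/-- Window `d+2` is separated at `x_d - ε`. -/
theorem window_dsucc2 (n : ℕ) (ε : ℝ) (hε : 0 < ε)
    (hεB : ε * ((n + 1) * (2 * n + 3) + 4 * n + 5 : ℝ) ≤ 1) (e o : ℕ)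
    (he1 : 2 * n + 3 ≤ e) (he2 : e ≤ 2 * n + 3 + (2 * n + 1)) (ho1 : 2 * n + 3 ≤ o)
    (ho2 : o ≤ 2 * n + 3 + (2 * n + 1)) (he : Even e) (ho : ¬ Even o) :
    (bM n o : ℝ) + (sM n o : ℝ) * ((2 * n + 1 : ℕ) - ε) <
      (bM n e : ℝ) + (sM n e : ℝ) * ((2 * n + 1 : ℕ) - ε) := by
  rw [val_at n o (2 * n + 1), val_at n e (2 * n + 1)]
  have hrange : e ≤ 2 * n + 1 + (2 * n + 2) ∨ (e = 4 * n + 4 ∧ 2 * n + 1 = 2 * n + 1) := by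
    rcases Nat.lt_or_ge e (4 * n + 4) with h | h
    · exact Or.inl (by omega)
    · exact Or.inr ⟨by omega, rfl⟩
  have wE := (EM_weak n e (2 * n + 1) le_rfl (by omega) hrange).1 he
  have ho3 : o ≤ 2 * n + 1 + (2 * n + 2) := by
    rcases Nat.even_or_odd o with ⟨c, hc⟩ | ⟨c, hc⟩
    · exact absurd ⟨c, hc⟩ ho
    · omega
  have wO := (EM_weak n o (2 * n + 1) le_rfl (by omega) (Or.inl ho3)).2 ho
  have hsd := slope_diff_small n e o (by omega) (by omega) ε hε hεB
  rw [abs_lt] at hsd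
  by_cases htight : e = 4 * n + 4 ∧ o = 4 * n + 3
  · obtain ⟨rfl, rfl⟩ := htight
    have h0 : EM n (4 * n + 4) (2 * n + 1) = 0 := EM_top n
    have h1 : EM n (4 * n + 3) (2 * n + 1) = 0 := by
      have := EM_far n (2 * n + 1) le_rfl
      have e : 2 * n + 1 + (2 * n + 2) = 4 * n + 3 := by ring
      rwa [e] at this
    rw [h0, h1, sM_u2d2, sM_l2d1]; push_cast; nlinarith
  · have key : EM n o (2 * n + 1) + 1 ≤ EM n e (2 * n + 1) := by
      by_cases he0 : e = 4 * n + 4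
      · have ho1 : o ≠ 4 * n + 3 := fun h => htight ⟨he0, h⟩
        have ho3 : o ≤ 2 * n + 1 + (2 * n + 1) := by
          rcases Nat.even_or_odd o with ⟨c, hc⟩ | ⟨c, hc⟩
          · exact absurd ⟨c, by omega⟩ ho
          · omega
        have := (EM_strict n o (2 * n + 1) le_rfl (by omega) ho3).2 ho
        linarith
      · have he4 : e ≤ 2 * n + 1 + (2 * n + 1) := by
          rcases Nat.even_or_odd e with ⟨c, hc⟩ | ⟨c, hc⟩
          · omega
          · exact absurd he (by rw [Nat.even_iff]; omega)
        have he3 : 2 * n + 1 + 2 ≤ e := by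
          rcases Nat.even_or_odd e with ⟨c, hc⟩ | ⟨c, hc⟩
          · omega
          · exact absurd he (by rw [Nat.even_iff]; omega)
        have := (EM_strict n e (2 * n + 1) le_rfl he3 he4).1 he
        linarith
    have key' : ((EM n o (2 * n + 1) : ℤ) : ℝ) + 1 ≤ (EM n e (2 * n + 1) : ℤ) := by exact_mod_cast key
    push_cast
    nlinarith

end Summit.ValiantsHypothesis.ValiantsHypothesis.Theorems.KPlusLogSqLawStepSharpWindows
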